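import Literature.MathematicalPhysics.QuantumFieldTheory.Balaban1983to89.Node00.CanonicalTransportOfRecord
import Literature.MathematicalPhysics.QuantumFieldTheory.Balaban1983to89.Node00.Record12ContTResidue

/-!
# NODE 00 — THE FIBRED-CHART (JACOBIAN-FACE) CRITERION FOR THE MAXIMAL REGULAR SET OF THE KERNEL TRANSFORM

Cell `pub-ymgap` (YM-PLAN Track A), width seat `pub-ymgap-dag-n09-w6` g2 (node N09 [B12]); helper of K1⁷ stmt-QuantumFields-20542 (`--supports`, count-neutral).
[I] = [Balaban1987RG1].  The measure-theoretic skeleton of step M4 of K0e's located-open (F1) programme (`F1-PROGRAMME-DESIGN.md`): HOW LARGE the maximal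
regular set `regSet` (FILE 6 `Node00.CanonicalTransportOfRecord`) of the kernel transform `(Tρ)(V) = ∫ dU δ(ŪV⁻¹) ρ(U)` is, is decided by a CHART OF THE FIBRES.
* §1 LOCAL DETERMINACY BY TESTS: a candidate `g`, continuous on an open `U`, with the (0.13) push-forward identity against every bounded measurable test
  SUPPORTED IN `U`, IS a version of `T` on `U` (`hasContVersionOn_of_forall_integral_mul_eq`), so `U ⊆ regSet μ T` and `canonVersion μ T = g` at EVERY point
  of `U` — no a.e.-representation hypothesis (contrast FILE 1's (0.19) constructors `hasContTransportOn_of_exp_repr`), only integrals.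
* §2 THE JACOBIAN FACE ([I] (2.10) p. 267 «∫dV δ(V̄W⁻¹)χ… = ∫dB′σ(B′)δ(Q(B′))…», read along DISPLAYED data): a measurable chart `Φ : (coarse) × Z → (fine)` of the
  part of the fibres over `U` carrying `ρ` (`avg (Φ (V,z)) = V`), a σ-finite fibre measure `τ`, a measurable Jacobian `J ≥ 0` and the change-of-variables identity
  `ν⌊(avg⁻¹U ∩ S) = Φ_*((μ⌊U ⊗ τ)·J)` turn `∫ ρ·(f∘avg) dν` into `∫ (∫ J(V,z)ρ(Φ(V,z)) dτ)·f(V) dμ` (`integral_mul_comp_eq_integral_fibreIntegral_mul`: `integral_map`,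
  `withDensity`, Fubini).  §3 continuity of the fibre integral by domination.  §4 assembly for ANY transform in the push-forward reading (`Setup.IsRT` shape).
* §5 AT THE RECORD (`SU(N)`, `avOfRecord`, `transportOfRecord`, `k < K`, integrable `ρ`): the continuous-candidate door (`subset_regSetOfRecord_of_forall_integral_eq`,
  `hasContTransportOn_of_forall_integral_eq`, `TcanOfRecord_eqOn_of_forall_integral_eq`) and the fibred-chart door (`subset_regSetOfRecord_of_fibredChart`,
  `hasContTransportOn_of_fibredChart`, `TcanOfRecord_eqOn_fibreIntegral_of_fibredChart`); at `U := domAltOfRecord ν K (k+1)` the conclusion is the displayed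
  analytic-inclusion binder `hreg : domAltOfRecord … (k+1) ⊆ regSetOfRecord … k ρ` of N09's Theorem-3 doors at the Stage-13 record, at one `k`
  (`domAlt_subset_regSetOfRecord_of_fibredChart`).
NOT HERE (displayed as hypotheses, never asserted): the construction of the chart — [I]'s linearisation `B₁ = B′ − hD_W(B′)` and the Haar density in the chart
(K0e's M2∕M3; the EUCLIDEAN engine turning a C¹ injective fibre parametrisation into such an identity is dag-n09-w2 g3's `Literature/MeasureTheory/Integral/
FibreCoordinatesPushforwardDensity.lean`) — and the continuity of the chart integrand in the coarse field (N07's [B11] Thm 1 input).  HONEST FRAMING: measure theory read at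
NODE 00's objects BY NAME; no estimate of Bałaban's; `hreg` RE-SHAPED (∃ version ↦ ∃ chart), NOT discharged; N09 NOT discharged; K0⁷∕K1⁷ NOT closed; counts unmoved;
one finite four-torus programme — NOT continuum ∕ ℝ⁴ ∕ OS ∕ mass gap ∕ Clay.  Theorems only: no `def`, `instance`, `notation`, `sorry`, `axiom`.
-/

noncomputable section

open MeasureTheory Set Filter
open scoped ENNReal NNReal Topology

namespace Literature.MathematicalPhysics.QuantumFieldTheory.Balaban1983to89.Node00

open _root_.Topology _root_.MeasureTheory
open T4Continuum (T4Family)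
open B12ContinuousTransportInvarianceOn (isOpen_domAltOfRecord)

/-! ## §1. Local determinacy by tests; the continuous-candidate criterion (generic) -/

section LocalDeterminacy

variable {α : Type*} [MeasurableSpace α] {μ : Measure α}

/-- **LOCAL A.E.-DETERMINACY BY TESTS.**  Two functions integrable on a measurable set `U` whose integrals against every bounded measurable test
function VANISHING OFF `U` coincide agree `μ`-a.e. on `U` (test with the indicators of the measurable subsets of `U`). [cite: Balaban1987RG1, (0.13) p.254 (bookkeeping)] -/
theorem ae_eq_restrict_of_forall_integral_mul_eq {U : Set α} (hU : MeasurableSet U) {ρ₁ ρ₂ : α → ℝ}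
    (h₁ : IntegrableOn ρ₁ U μ) (h₂ : IntegrableOn ρ₂ U μ)
    (h : ∀ f : α → ℝ, Measurable f → (∃ C : ℝ, ∀ x, |f x| ≤ C) → (∀ x, x ∉ U → f x = 0) →
      ∫ x, ρ₁ x * f x ∂μ = ∫ x, ρ₂ x * f x ∂μ) :
    ρ₁ =ᵐ[μ.restrict U] ρ₂ := by
  refine Integrable.ae_eq_of_forall_setIntegral_eq ρ₁ ρ₂ h₁ h₂ fun s hs _ => ?_
  rw [Measure.restrict_restrict hs]
  have hsU : MeasurableSet (s ∩ U) := hs.inter hU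
  have key := h ((s ∩ U).indicator fun _ => (1 : ℝ)) (measurable_const.indicator hsU)
    ⟨1, fun x => by by_cases hx : x ∈ s ∩ U <;> simp [hx]⟩
    (fun x hx => by simp [Set.indicator_of_notMem (fun h' : x ∈ s ∩ U => hx h'.2)])
  have e : ∀ ρ : α → ℝ, (fun x => ρ x * (s ∩ U).indicator (fun _ => (1 : ℝ)) x) = (s ∩ U).indicator ρ := by
    intro ρ; funext x; by_cases hx : x ∈ s ∩ U <;> simp [hx]
  rw [e ρ₁, e ρ₂, integral_indicator hsU, integral_indicator hsU] at key
  exact key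

variable [TopologicalSpace α]

/-- **THE CONTINUOUS-CANDIDATE CRITERION.**  If `g` is continuous on `U`, integrable on `U`, and has the same integrals as `T` against every bounded
measurable test vanishing off the measurable set `U`, then `T` HAS A VERSION CONTINUOUS ON `U` (namely `g`). [cite: Balaban1987RG1, (0.13) p.254 (bookkeeping)] -/
theorem hasContVersionOn_of_forall_integral_mul_eq {U : Set α} (hU : MeasurableSet U) {T g : α → ℝ}
    (hT : IntegrableOn T U μ) (hg : IntegrableOn g U μ) (hgc : ContinuousOn g U)
    (h : ∀ f : α → ℝ, Measurable f → (∃ C : ℝ, ∀ x, |f x| ≤ C) → (∀ x, x ∉ U → f x = 0) →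
      ∫ x, T x * f x ∂μ = ∫ x, g x * f x ∂μ) :
    HasContVersionOn μ T U :=
  ⟨g, hgc, (ae_eq_restrict_of_forall_integral_mul_eq hU hT hg h).symm⟩

/-- … hence, for `U` OPEN and `g` merely LOCALLY integrable on `U`, `U` lies in the maximal regular open set of `T`
(work on a small open neighbourhood inside `U` of each point). [cite: Balaban1987RG1, (0.13) p.254 (bookkeeping)] -/
theorem subset_regSet_of_forall_integral_mul_eq [OpensMeasurableSpace α] {U : Set α} (hU : IsOpen U) {T g : α → ℝ}
    (hT : IntegrableOn T U μ) (hg : LocallyIntegrableOn g U μ) (hgc : ContinuousOn g U)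
    (h : ∀ f : α → ℝ, Measurable f → (∃ C : ℝ, ∀ x, |f x| ≤ C) → (∀ x, x ∉ U → f x = 0) →
      ∫ x, T x * f x ∂μ = ∫ x, g x * f x ∂μ) :
    U ⊆ regSet μ T := by
  intro x hx
  obtain ⟨s, hs, hgs⟩ := hg x hx
  obtain ⟨O, hOs, hO, hxO⟩ : ∃ O, O ∩ U ⊆ s ∧ IsOpen O ∧ x ∈ O := by
    rcases mem_nhdsWithin.1 hs with ⟨O, hO, hxO, hOs⟩
    exact ⟨O, hOs, hO, hxO⟩
  have hW : IsOpen (O ∩ U) := hO.inter hU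
  refine mem_regSet_iff.2 ⟨O ∩ U, hW, ⟨hxO, hx⟩, ?_⟩
  refine hasContVersionOn_of_forall_integral_mul_eq hW.measurableSet (hT.mono_set inter_subset_right)
    (hgs.mono_set hOs) (hgc.mono inter_subset_right) fun f hf hfC hf0 => ?_
  exact h f hf hfC fun y hy => hf0 y fun hy' => hy hy'.2

/-- **THE CANONICAL VERSION IS THE CANDIDATE, POINTWISE ON `U`**: for `U` open, second-countable `α` and open-positive `μ`, a continuous, locally integrable
candidate `g` with the test identity on `U` EQUALS K0e's `canonVersion μ T` at EVERY point of `U` (local a.e.-agreement on a small open neighbourhood, then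
determinacy of continuous functions a.e.-equal on an open set, Mathlib `Measure.eqOn_open_of_ae_eq`; no gluing needed). [cite: Balaban1987RG1, (0.13) p.254 (bookkeeping)] -/
theorem canonVersion_eqOn_of_forall_integral_mul_eq [SecondCountableTopology α] [OpensMeasurableSpace α] [μ.IsOpenPosMeasure] {U : Set α}
    (hU : IsOpen U) {T g : α → ℝ} (hT : IntegrableOn T U μ) (hg : LocallyIntegrableOn g U μ) (hgc : ContinuousOn g U)
    (h : ∀ f : α → ℝ, Measurable f → (∃ C : ℝ, ∀ x, |f x| ≤ C) → (∀ x, x ∉ U → f x = 0) →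
      ∫ x, T x * f x ∂μ = ∫ x, g x * f x ∂μ) :
    EqOn (canonVersion μ T) g U := by
  have hsub : U ⊆ regSet μ T := subset_regSet_of_forall_integral_mul_eq hU hT hg hgc h
  have hc : ContinuousOn (canonVersion μ T) U := continuousOn_canonVersion.mono hsub
  intro x hx
  obtain ⟨s, hs, hgs⟩ := hg x hx
  obtain ⟨O, hOs, hO, hxO⟩ : ∃ O, O ∩ U ⊆ s ∧ IsOpen O ∧ x ∈ O := by
    rcases mem_nhdsWithin.1 hs with ⟨O, hO, hxO, hOs⟩
    exact ⟨O, hOs, hO, hxO⟩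
  have hW : IsOpen (O ∩ U) := hO.inter hU
  have hae : T =ᵐ[μ.restrict (O ∩ U)] g :=
    ae_eq_restrict_of_forall_integral_mul_eq hW.measurableSet (hT.mono_set inter_subset_right) (hgs.mono_set hOs)
      fun f hf hfC hf0 => h f hf hfC fun y hy => hf0 y fun hy' => hy hy'.2
  have hae₀ : canonVersion μ T =ᵐ[μ.restrict (O ∩ U)] T := ae_restrict_of_ae canonVersion_ae_eq
  have hae' : canonVersion μ T =ᵐ[μ.restrict (O ∩ U)] g := hae₀.trans hae
  exact Measure.eqOn_open_of_ae_eq hae' hW (hc.mono inter_subset_right) (hgc.mono inter_subset_right) ⟨hxO, hx⟩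

/-- … and continuity itself supplies the local integrability when `μ` is locally finite. [cite: Balaban1987RG1, (0.13) p.254 (bookkeeping)] -/
theorem subset_regSet_of_continuousOn_of_forall_integral_mul_eq [OpensMeasurableSpace α] [IsLocallyFiniteMeasure μ]
    {U : Set α} (hU : IsOpen U) {T g : α → ℝ} (hT : IntegrableOn T U μ) (hgc : ContinuousOn g U)
    (h : ∀ f : α → ℝ, Measurable f → (∃ C : ℝ, ∀ x, |f x| ≤ C) → (∀ x, x ∉ U → f x = 0) →
      ∫ x, T x * f x ∂μ = ∫ x, g x * f x ∂μ) :
    U ⊆ regSet μ T :=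
  subset_regSet_of_forall_integral_mul_eq hU hT (hgc.locallyIntegrableOn hU.measurableSet) hgc h

end LocalDeterminacy

/-! ## §2. The Jacobian face: a fibred chart of the averaging over `U` on the support of `ρ` turns `∫ ρ·(f∘avg) dν` into
`∫ (fibre integral)·f dμ` (generic change of variables + Fubini) -/

section FibredChart

variable {α β Z : Type*} [MeasurableSpace α] [MeasurableSpace β] [MeasurableSpace Z]
  {ν : Measure β} {μ : Measure α} {τ : Measure Z} {avg : β → α} {U : Set α} {S : Set β} {Φ : α × Z → β} {J : α × Z → ℝ≥0}

/-- **INTEGRABILITY ALONG A FIBRED CHART.**  If the fine measure restricted to `avg ⁻¹' U ∩ S` is the image under the chart `Φ` of the product of the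
coarse measure on `U` with the fibre measure `τ`, weighted by the Jacobian `J`, then for every `ν`-integrable `ρ` the chart integrand
`(V, z) ↦ J(V,z)·ρ(Φ(V,z))` is integrable for `(μ⌊U) ⊗ τ`. [cite: Balaban1987RG1, (2.10) p.267 (bookkeeping)] -/
theorem integrable_jacobian_mul_comp_of_fibredChart (hΦ : Measurable Φ) (hJ : Measurable J)
    (hmap : ν.restrict (avg ⁻¹' U ∩ S) = (((μ.restrict U).prod τ).withDensity (fun p => (J p : ℝ≥0∞))).map Φ)
    {ρ : β → ℝ} (hρ : Integrable ρ ν) :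
    Integrable (fun p : α × Z => (J p : ℝ) * ρ (Φ p)) ((μ.restrict U).prod τ) := by
  have h1 : Integrable ρ (ν.restrict (avg ⁻¹' U ∩ S)) := hρ.restrict
  rw [hmap] at h1
  have h2 : Integrable (ρ ∘ Φ) (((μ.restrict U).prod τ).withDensity (fun p => (J p : ℝ≥0∞))) :=
    (integrable_map_measure h1.aestronglyMeasurable hΦ.aemeasurable).1 h1
  have h3 := (integrable_withDensity_iff_integrable_smul hJ).1 h2
  refine h3.congr (ae_of_all _ fun p => ?_)
  simp only [Function.comp_apply, NNReal.smul_def, smul_eq_mul]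

/-- **THE JACOBIAN FACE OF THE PUSH-FORWARD IDENTITY** (the shape of [I] (2.10): «∫dV δ(V̄W⁻¹) χ … = ∫dB′ σ(B′) δ(Q(B′)) …», read along a DISPLAYED
chart).  Let `Φ : α × Z → β` be a measurable chart over `U` of the part of the fibres of `avg` that carries `ρ` — `avg (Φ (V, z)) = V` on `U`, and the fine
measure on `avg ⁻¹' U ∩ S` (with `S ⊇ {ρ ≠ 0}`) is `Φ_*((μ⌊U ⊗ τ)·J)`.  Then for every bounded measurable test `f` vanishing off the measurable set `U`,
`∫ ρ(x)·f(avg x) dν(x) = ∫ (∫ J(V,z)·ρ(Φ(V,z)) dτ(z))·f(V) dμ(V)`: the transform of `ρ` tested on `U` IS the fibre integral.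
[cite: Balaban1987RG1, (2.10) p.267 and (0.13) p.254] -/
theorem integral_mul_comp_eq_integral_fibreIntegral_mul [SFinite μ] [SFinite τ] (hU : MeasurableSet U) (havg : Measurable avg)
    (hΦ : Measurable Φ) (hJ : Measurable J) (havgΦ : ∀ V ∈ U, ∀ z, avg (Φ (V, z)) = V)
    (hmap : ν.restrict (avg ⁻¹' U ∩ S) = (((μ.restrict U).prod τ).withDensity (fun p => (J p : ℝ≥0∞))).map Φ)
    {ρ : β → ℝ} (hρ : Integrable ρ ν) (hS : ∀ x, ρ x ≠ 0 → x ∈ S)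
    {f : α → ℝ} (hf : Measurable f) (hfC : ∃ C : ℝ, ∀ V, |f V| ≤ C) (hf0 : ∀ V, V ∉ U → f V = 0) :
    ∫ x, ρ x * f (avg x) ∂ν = ∫ V, (∫ z, (J (V, z) : ℝ) * ρ (Φ (V, z)) ∂τ) * f V ∂μ := by
  obtain ⟨C, hC⟩ := hfC
  -- (a) localise the fine integral to `avg ⁻¹' U ∩ S`
  have hloc : ∫ x, ρ x * f (avg x) ∂ν = ∫ x in avg ⁻¹' U ∩ S, ρ x * f (avg x) ∂ν := by
    refine (setIntegral_eq_integral_of_forall_compl_eq_zero fun x hx => ?_).symm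
    by_cases hxU : avg x ∈ U
    · have hxS : x ∉ S := fun h' => hx ⟨hxU, h'⟩
      have : ρ x = 0 := by
        by_contra hne
        exact hxS (hS x hne)
      rw [this, zero_mul]
    · rw [hf0 _ hxU, mul_zero]
  -- (b) change variables along the chart
  have hmeasν : AEStronglyMeasurable (fun x => ρ x * f (avg x)) (ν.restrict (avg ⁻¹' U ∩ S)) :=
    (hρ.aestronglyMeasurable.mul (hf.comp havg).aestronglyMeasurable).restrict
  have hchange : ∫ x in avg ⁻¹' U ∩ S, ρ x * f (avg x) ∂ν
      = ∫ p, (J p : ℝ) * (ρ (Φ p) * f (avg (Φ p))) ∂((μ.restrict U).prod τ) := by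
    rw [hmap] at hmeasν ⊢
    rw [integral_map hΦ.aemeasurable hmeasν, integral_withDensity_eq_integral_smul hJ]
    refine integral_congr_ae (ae_of_all _ fun p => ?_)
    simp only [NNReal.smul_def, smul_eq_mul]
  -- (c) integrability of the chart integrand (with the bounded test factor)
  have hint : Integrable (fun p : α × Z => (J p : ℝ) * (ρ (Φ p) * f (avg (Φ p)))) ((μ.restrict U).prod τ) := by
    have hb := integrable_jacobian_mul_comp_of_fibredChart hΦ hJ hmap hρ
    have hm : AEStronglyMeasurable (fun p : α × Z => f (avg (Φ p))) ((μ.restrict U).prod τ) :=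
      (hf.comp (havg.comp hΦ)).aestronglyMeasurable
    have h' : Integrable (fun p : α × Z => (J p : ℝ) * ρ (Φ p) * f (avg (Φ p))) ((μ.restrict U).prod τ) :=
      hb.mul_bdd (c := C) hm (Filter.Eventually.of_forall fun p => by simpa [Real.norm_eq_abs] using hC (avg (Φ p)))
    exact h'.congr (ae_of_all _ fun p => by ring)
  -- (d) Fubini, and the chart lies over `U`: `avg (Φ (V, z)) = V` for `μ⌊U`-a.e. `V`
  have hfub : ∫ p, (J p : ℝ) * (ρ (Φ p) * f (avg (Φ p))) ∂((μ.restrict U).prod τ)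
      = ∫ V, (∫ z, (J (V, z) : ℝ) * ρ (Φ (V, z)) ∂τ) * f V ∂(μ.restrict U) := by
    rw [integral_prod _ hint]
    refine integral_congr_ae ?_
    filter_upwards [ae_restrict_mem hU] with V hV
    rw [← integral_mul_const]
    refine integral_congr_ae (ae_of_all _ fun z => ?_)
    simp only
    rw [havgΦ V hV z]
    ring
  -- (e) back to the whole coarse space: `f` vanishes off `U`
  have hback : ∫ V, (∫ z, (J (V, z) : ℝ) * ρ (Φ (V, z)) ∂τ) * f V ∂(μ.restrict U)
      = ∫ V, (∫ z, (J (V, z) : ℝ) * ρ (Φ (V, z)) ∂τ) * f V ∂μ :=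
    setIntegral_eq_integral_of_forall_compl_eq_zero fun V hV => by rw [hf0 V hV, mul_zero]
  rw [hloc, hchange, hfub, hback]

/-- The fibre integral of an integrable density along a fibred chart over `U` is integrable on `U`. [cite: Balaban1987RG1, (2.10) p.267 (bookkeeping)] -/
theorem integrableOn_fibreIntegral_of_fibredChart [SFinite τ] (hΦ : Measurable Φ) (hJ : Measurable J)
    (hmap : ν.restrict (avg ⁻¹' U ∩ S) = (((μ.restrict U).prod τ).withDensity (fun p => (J p : ℝ≥0∞))).map Φ)
    {ρ : β → ℝ} (hρ : Integrable ρ ν) :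
    IntegrableOn (fun V => ∫ z, (J (V, z) : ℝ) * ρ (Φ (V, z)) ∂τ) U μ :=
  (integrable_jacobian_mul_comp_of_fibredChart hΦ hJ hmap hρ).integral_prod_left

end FibredChart

/-! ## §3. Continuity of the fibre integral by domination (Mathlib `continuousOn_of_dominated`, stated for the chart integrand) -/

section Continuity

variable {α β Z : Type*} [TopologicalSpace α] [FirstCountableTopology α] [MeasurableSpace Z] {τ : Measure Z}
  {U : Set α} {Φ : α × Z → β} {J : α × Z → ℝ≥0} {ρ : β → ℝ}

/-- **CONTINUITY OF THE FIBRE INTEGRAL ON `U`** from a `τ`-integrable bound and continuity in the coarse variable of the chart integrand `J(V,z)·ρ(Φ(V,z))` for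
a.e. fibre coordinate `z` (dominated convergence).  In [I]'s (2.10) substitution this is «the integrand is a continuous function of the background `V^{(k)}(W)`
on the fixed compact domain `|B₁| < ε₁, Q B₁ = 0`» — the continuity input is N07's ([B11] Thm 1), displayed here. [cite: Balaban1987RG1, (2.10) p.267] -/
theorem continuousOn_fibreIntegral_of_dominated
    (hmeas : ∀ V ∈ U, AEStronglyMeasurable (fun z => (J (V, z) : ℝ) * ρ (Φ (V, z))) τ)
    (bound : Z → ℝ) (hbound : Integrable bound τ)
    (hle : ∀ V ∈ U, ∀ᵐ z ∂τ, ‖(J (V, z) : ℝ) * ρ (Φ (V, z))‖ ≤ bound z)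
    (hcont : ∀ᵐ z ∂τ, ContinuousOn (fun V => (J (V, z) : ℝ) * ρ (Φ (V, z))) U) :
    ContinuousOn (fun V => ∫ z, (J (V, z) : ℝ) * ρ (Φ (V, z)) ∂τ) U :=
  continuousOn_of_dominated (F := fun V z => (J (V, z) : ℝ) * ρ (Φ (V, z))) hmeas hle hbound hcont

end Continuity

/-! ## §4. Generic assembly: ANY transform satisfying the push-forward identity (the `Setup.IsRT` shape; the kernel transport is one) has the fibre integral as
a continuous version on `U`, `U ⊆ regSet`, and its canonical version IS the fibre integral on `U` -/

section Assembly

variable {α β Z : Type*} [TopologicalSpace α] [MeasurableSpace α] [OpensMeasurableSpace α] [MeasurableSpace β] [MeasurableSpace Z]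
  {ν : Measure β} {μ : Measure α} {τ : Measure Z} [SFinite μ] [SFinite τ]
  {avg : β → α} {U : Set α} {S : Set β} {Φ : α × Z → β} {J : α × Z → ℝ≥0}

/-- **FIBRED CHART ⇒ CONTINUOUS VERSION ON `U`.**  A transform `T` of the integrable density `ρ` in the push-forward reading (`∫ T·f dμ = ∫ ρ·(f∘avg) dν` for
bounded measurable `f`), integrable on the open set `U`; a fibred chart of `avg` over `U` on the support of `ρ`; the fibre integral continuous on `U`
⇒ `T` has a version continuous on `U`, namely the fibre integral. [cite: Balaban1987RG1, (0.13) p.254 and (2.10) p.267] -/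
theorem hasContVersionOn_transform_of_fibredChart (hU : IsOpen U) (havg : Measurable avg)
    (hΦ : Measurable Φ) (hJ : Measurable J) (havgΦ : ∀ V ∈ U, ∀ z, avg (Φ (V, z)) = V)
    (hmap : ν.restrict (avg ⁻¹' U ∩ S) = (((μ.restrict U).prod τ).withDensity (fun p => (J p : ℝ≥0∞))).map Φ)
    {ρ : β → ℝ} (hρ : Integrable ρ ν) (hS : ∀ x, ρ x ≠ 0 → x ∈ S) {T : α → ℝ} (hTi : IntegrableOn T U μ)
    (hT : ∀ f : α → ℝ, Measurable f → (∃ C : ℝ, ∀ V, |f V| ≤ C) → ∫ V, T V * f V ∂μ = ∫ x, ρ x * f (avg x) ∂ν)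
    (hgc : ContinuousOn (fun V => ∫ z, (J (V, z) : ℝ) * ρ (Φ (V, z)) ∂τ) U) :
    HasContVersionOn μ T U :=
  hasContVersionOn_of_forall_integral_mul_eq hU.measurableSet hTi (integrableOn_fibreIntegral_of_fibredChart hΦ hJ hmap hρ) hgc
    fun f hf hfC hf0 =>
      (hT f hf hfC).trans (integral_mul_comp_eq_integral_fibreIntegral_mul hU.measurableSet havg hΦ hJ havgΦ hmap hρ hS hf hfC hf0)

/-- **FIBRED CHART ⇒ `U ⊆ regSet μ T`.** [cite: Balaban1987RG1, (0.13) p.254 and (2.10) p.267] -/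
theorem subset_regSet_transform_of_fibredChart (hU : IsOpen U) (havg : Measurable avg)
    (hΦ : Measurable Φ) (hJ : Measurable J) (havgΦ : ∀ V ∈ U, ∀ z, avg (Φ (V, z)) = V)
    (hmap : ν.restrict (avg ⁻¹' U ∩ S) = (((μ.restrict U).prod τ).withDensity (fun p => (J p : ℝ≥0∞))).map Φ)
    {ρ : β → ℝ} (hρ : Integrable ρ ν) (hS : ∀ x, ρ x ≠ 0 → x ∈ S) {T : α → ℝ} (hTi : IntegrableOn T U μ)
    (hT : ∀ f : α → ℝ, Measurable f → (∃ C : ℝ, ∀ V, |f V| ≤ C) → ∫ V, T V * f V ∂μ = ∫ x, ρ x * f (avg x) ∂ν)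
    (hgc : ContinuousOn (fun V => ∫ z, (J (V, z) : ℝ) * ρ (Φ (V, z)) ∂τ) U) :
    U ⊆ regSet μ T :=
  subset_regSet hU (hasContVersionOn_transform_of_fibredChart hU havg hΦ hJ havgΦ hmap hρ hS hTi hT hgc)

end Assembly

/-! ## §5. At the record: `G = SU(N)`, the averaging of record `avOfRecord F N K k`, the kernel transform of record `transportOfRecord F N K k ρ`
(`k < K`, `ρ` integrable), the coarse configuration space `PBond (F.P K) (k+1) → SU N` with its Pi topology and product Haar measure `piHaar` -/

section Record

variable {F : T4Family} {N : ℕ} [NeZero N]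

/-- **THE CONTINUOUS-CANDIDATE DOOR AT THE RECORD (i): the maximal regular set.**  If `g` is continuous on an open set `U` of coarse fields and satisfies the
(0.13) push-forward identity `∫ ρ(U)·f(Ū) dU = ∫ g(V)·f(V) dV` for every bounded measurable test `f` SUPPORTED IN `U`, then `U ⊆ regSetOfRecord F N K k ρ` —
NO a.e.-representation hypothesis (contrast FILE 1's `hasContTransportOn_of_exp_repr`), only integrals. [cite: Balaban1987RG1, (0.13) p.254 and (0.19) p.255] -/
theorem subset_regSetOfRecord_of_forall_integral_eq {K k : ℕ} (hk : k < K) {ρ : Density (F.P K) k (SU N)}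
    (hρ : Integrable ρ (fieldMeasure (F.P K) k (SU N))) {U : Set (PBond (F.P K) (k + 1) → SU N)} (hU : IsOpen U)
    {g : (PBond (F.P K) (k + 1) → SU N) → ℝ} (hgc : ContinuousOn g U)
    (h : ∀ f : (PBond (F.P K) (k + 1) → SU N) → ℝ, Measurable f → (∃ C : ℝ, ∀ V, |f V| ≤ C) → (∀ V, V ∉ U → f V = 0) →
      ∫ x, ρ x * f ((avOfRecord F N K k).avg x) ∂(fieldMeasure (F.P K) k (SU N)) = ∫ V, g V * f V ∂(piHaar (F.P K) (k + 1) (SU N))) :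
    U ⊆ regSetOfRecord F N K k ρ := by
  haveI : IsFiniteMeasure (piHaar (F.P K) (k + 1) (SU N)) :=
    inferInstanceAs (IsFiniteMeasure (fieldMeasure (F.P K) (k + 1) (SU N)))
  have hTi : IntegrableOn (fun V : PBond (F.P K) (k + 1) → SU N => transportOfRecord F N K k ρ V) U (piHaar (F.P K) (k + 1) (SU N)) :=
    (integrable_transportOfRecord hk hρ).integrableOn
  refine subset_regSet_of_continuousOn_of_forall_integral_mul_eq hU hTi hgc fun f hf hfC hf0 => ?_
  rw [← h f hf hfC hf0]
  exact isRT_transportOfRecord F N K k hk ρ hρ f hf hfC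

/-- **THE CONTINUOUS-CANDIDATE DOOR AT THE RECORD (ii): the on-domain proviso.**  Same hypotheses ⇒ FILE 1's `HasContTransportOn F N K k ρ U` (a version of the
transform of record continuous on `U`; via K0e's countable gluing `hasContVersionOn_regSet` restricted to `U` — no global integrability of `g` on `U` is asked).
[cite: Balaban1987RG1, (0.13) p.254 and p.259] -/
theorem hasContTransportOn_of_forall_integral_eq {K k : ℕ} (hk : k < K) {ρ : Density (F.P K) k (SU N)}
    (hρ : Integrable ρ (fieldMeasure (F.P K) k (SU N))) {U : Set (PBond (F.P K) (k + 1) → SU N)} (hU : IsOpen U)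
    {g : (PBond (F.P K) (k + 1) → SU N) → ℝ} (hgc : ContinuousOn g U)
    (h : ∀ f : (PBond (F.P K) (k + 1) → SU N) → ℝ, Measurable f → (∃ C : ℝ, ∀ V, |f V| ≤ C) → (∀ V, V ∉ U → f V = 0) →
      ∫ x, ρ x * f ((avOfRecord F N K k).avg x) ∂(fieldMeasure (F.P K) k (SU N)) = ∫ V, g V * f V ∂(piHaar (F.P K) (k + 1) (SU N))) :
    HasContTransportOn F N K k ρ U :=
  haveI := isOpenPosMeasure_piHaar_SUN N (F.P K) (k + 1)
  hasContVersionOn_regSet.mono (subset_regSetOfRecord_of_forall_integral_eq hk hρ hU hgc h)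

/-- **THE CONTINUOUS-CANDIDATE DOOR AT THE RECORD (iii): `TcanOfRecord` IS the candidate at every point of `U`.**  Print's `𝐍_k·exp A_{k+1}` — or ANY function
continuous on an open set of coarse fields that satisfies (0.13) against the tests supported there — IS the canonical-version transport of record on that set,
pointwise, with no field of any record certifying it. [cite: Balaban1987RG1, (0.13) p.254 and (0.19) p.255] -/
theorem TcanOfRecord_eqOn_of_forall_integral_eq {K k : ℕ} (hk : k < K) {ρ : Density (F.P K) k (SU N)}
    (hρ : Integrable ρ (fieldMeasure (F.P K) k (SU N))) {U : Set (PBond (F.P K) (k + 1) → SU N)} (hU : IsOpen U)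
    {g : (PBond (F.P K) (k + 1) → SU N) → ℝ} (hgc : ContinuousOn g U)
    (h : ∀ f : (PBond (F.P K) (k + 1) → SU N) → ℝ, Measurable f → (∃ C : ℝ, ∀ V, |f V| ≤ C) → (∀ V, V ∉ U → f V = 0) →
      ∫ x, ρ x * f ((avOfRecord F N K k).avg x) ∂(fieldMeasure (F.P K) k (SU N)) = ∫ V, g V * f V ∂(piHaar (F.P K) (k + 1) (SU N))) :
    EqOn (TcanOfRecord F N K k ρ) g U := by
  haveI := isOpenPosMeasure_piHaar_SUN N (F.P K) (k + 1)
  haveI : IsFiniteMeasure (piHaar (F.P K) (k + 1) (SU N)) :=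
    inferInstanceAs (IsFiniteMeasure (fieldMeasure (F.P K) (k + 1) (SU N)))
  have hTi : IntegrableOn (fun V : PBond (F.P K) (k + 1) → SU N => transportOfRecord F N K k ρ V) U (piHaar (F.P K) (k + 1) (SU N)) :=
    (integrable_transportOfRecord hk hρ).integrableOn
  rw [TcanOfRecord_apply]
  refine canonVersion_eqOn_of_forall_integral_mul_eq hU hTi (hgc.locallyIntegrableOn hU.measurableSet) hgc fun f hf hfC hf0 => ?_
  rw [← h f hf hfC hf0]
  exact isRT_transportOfRecord F N K k hk ρ hρ f hf hfC

variable {Z : Type*} [MeasurableSpace Z] {τ : Measure Z} [SFinite τ]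

/-- **THE JACOBIAN FACE AT THE RECORD: a fibred chart of the averaging of record over `U` ⇒ `U ⊆ regSetOfRecord`.**  DISPLAYED DATA: a measurable chart
`Φ : (coarse fields) × Z → (fine fields)` with `Ū(Φ(V,z)) = V` on `U`, a σ-finite fibre measure `τ`, a measurable Jacobian `J ≥ 0`, the CHANGE-OF-VARIABLES
identity `dU⌊(Ū⁻¹U ∩ S) = Φ_*((dV⌊U ⊗ τ)·J)` on a set `S` carrying `ρ` (what [I]'s (2.10) linearisation `B₁ = B′ − hD_W(B′)` and the Haar density in the chart
must PRODUCE — not constructed here), and continuity on `U` of the fibre integral `V ↦ ∫ J(V,z)·ρ(Φ(V,z)) dτ(z)` (§3; N07's input).  CONCLUSION: `U` lies in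
the maximal regular set of the transform of record of `ρ`.  Nothing of Bałaban's asserted. [cite: Balaban1987RG1, (2.10) p.267, (0.13) p.254 and p.259] -/
theorem subset_regSetOfRecord_of_fibredChart {K k : ℕ} (hk : k < K) {ρ : Density (F.P K) k (SU N)}
    (hρ : Integrable ρ (fieldMeasure (F.P K) k (SU N))) {U : Set (PBond (F.P K) (k + 1) → SU N)} (hU : IsOpen U)
    {S : Set (GaugeField (F.P K) k (SU N))} (hS : ∀ x, ρ x ≠ 0 → x ∈ S)
    {Φ : (PBond (F.P K) (k + 1) → SU N) × Z → GaugeField (F.P K) k (SU N)} {J : (PBond (F.P K) (k + 1) → SU N) × Z → ℝ≥0}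
    (hΦ : Measurable Φ) (hJ : Measurable J) (havgΦ : ∀ V ∈ U, ∀ z, (avOfRecord F N K k).avg (Φ (V, z)) = V)
    (hmap : (fieldMeasure (F.P K) k (SU N)).restrict ((avOfRecord F N K k).avg ⁻¹' U ∩ S)
      = ((((piHaar (F.P K) (k + 1) (SU N)).restrict U).prod τ).withDensity (fun p => (J p : ℝ≥0∞))).map Φ)
    (hgc : ContinuousOn (fun V => ∫ z, (J (V, z) : ℝ) * ρ (Φ (V, z)) ∂τ) U) :
    U ⊆ regSetOfRecord F N K k ρ := by
  haveI : IsFiniteMeasure (piHaar (F.P K) (k + 1) (SU N)) :=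
    inferInstanceAs (IsFiniteMeasure (fieldMeasure (F.P K) (k + 1) (SU N)))
  refine subset_regSetOfRecord_of_forall_integral_eq hk hρ hU hgc fun f hf hfC hf0 => ?_
  exact integral_mul_comp_eq_integral_fibreIntegral_mul hU.measurableSet (avOfRecord_measurable F N K k) hΦ hJ havgΦ hmap hρ hS
    hf hfC hf0

/-- **… ⇒ the on-domain proviso `HasContTransportOn F N K k ρ U`** (FILE 1's shape, at one density and one open set). [cite: Balaban1987RG1, (2.10) p.267 and p.259] -/
theorem hasContTransportOn_of_fibredChart {K k : ℕ} (hk : k < K) {ρ : Density (F.P K) k (SU N)}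
    (hρ : Integrable ρ (fieldMeasure (F.P K) k (SU N))) {U : Set (PBond (F.P K) (k + 1) → SU N)} (hU : IsOpen U)
    {S : Set (GaugeField (F.P K) k (SU N))} (hS : ∀ x, ρ x ≠ 0 → x ∈ S)
    {Φ : (PBond (F.P K) (k + 1) → SU N) × Z → GaugeField (F.P K) k (SU N)} {J : (PBond (F.P K) (k + 1) → SU N) × Z → ℝ≥0}
    (hΦ : Measurable Φ) (hJ : Measurable J) (havgΦ : ∀ V ∈ U, ∀ z, (avOfRecord F N K k).avg (Φ (V, z)) = V)
    (hmap : (fieldMeasure (F.P K) k (SU N)).restrict ((avOfRecord F N K k).avg ⁻¹' U ∩ S)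
      = ((((piHaar (F.P K) (k + 1) (SU N)).restrict U).prod τ).withDensity (fun p => (J p : ℝ≥0∞))).map Φ)
    (hgc : ContinuousOn (fun V => ∫ z, (J (V, z) : ℝ) * ρ (Φ (V, z)) ∂τ) U) :
    HasContTransportOn F N K k ρ U :=
  haveI := isOpenPosMeasure_piHaar_SUN N (F.P K) (k + 1)
  hasContVersionOn_regSet.mono (subset_regSetOfRecord_of_fibredChart hk hρ hU hS hΦ hJ havgΦ hmap hgc)

/-- **… ⇒ `TcanOfRecord F N K k ρ` IS THE FIBRE INTEGRAL at every point of `U`** — the record's β reads, on `U`, the (2.10)-shaped integral over the fibre chart,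
pointwise and choice-free. [cite: Balaban1987RG1, (2.10) p.267 and (0.19) p.255] -/
theorem TcanOfRecord_eqOn_fibreIntegral_of_fibredChart {K k : ℕ} (hk : k < K) {ρ : Density (F.P K) k (SU N)}
    (hρ : Integrable ρ (fieldMeasure (F.P K) k (SU N))) {U : Set (PBond (F.P K) (k + 1) → SU N)} (hU : IsOpen U)
    {S : Set (GaugeField (F.P K) k (SU N))} (hS : ∀ x, ρ x ≠ 0 → x ∈ S)
    {Φ : (PBond (F.P K) (k + 1) → SU N) × Z → GaugeField (F.P K) k (SU N)} {J : (PBond (F.P K) (k + 1) → SU N) × Z → ℝ≥0}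
    (hΦ : Measurable Φ) (hJ : Measurable J) (havgΦ : ∀ V ∈ U, ∀ z, (avOfRecord F N K k).avg (Φ (V, z)) = V)
    (hmap : (fieldMeasure (F.P K) k (SU N)).restrict ((avOfRecord F N K k).avg ⁻¹' U ∩ S)
      = ((((piHaar (F.P K) (k + 1) (SU N)).restrict U).prod τ).withDensity (fun p => (J p : ℝ≥0∞))).map Φ)
    (hgc : ContinuousOn (fun V => ∫ z, (J (V, z) : ℝ) * ρ (Φ (V, z)) ∂τ) U) :
    EqOn (TcanOfRecord F N K k ρ) (fun V => ∫ z, (J (V, z) : ℝ) * ρ (Φ (V, z)) ∂τ) U := by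
  haveI : IsFiniteMeasure (piHaar (F.P K) (k + 1) (SU N)) :=
    inferInstanceAs (IsFiniteMeasure (fieldMeasure (F.P K) (k + 1) (SU N)))
  refine TcanOfRecord_eqOn_of_forall_integral_eq hk hρ hU hgc fun f hf hfC hf0 => ?_
  exact integral_mul_comp_eq_integral_fibreIntegral_mul hU.measurableSet (avOfRecord_measurable F N K k) hΦ hJ havgΦ hmap hρ hS
    hf hfC hf0

/-- **THE `hreg` BINDER SHAPE.**  At `U :=` the record's small-field domain of the NEXT step `domAltOfRecord ν K (k+1)` (open: `isOpen_domAltOfRecord`): a fibred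
chart of `avOfRecord F N K k` over it on the support of the integrable density `ρ`, with the fibre integral continuous there, gives
`domAltOfRecord F N ν K (k+1) ⊆ regSetOfRecord F N K k ρ` — at `ρ :=` the β-input density of step `k` this is, VERBATIM at one `k`, the displayed analytic-inclusion
hypothesis `hreg` of N09's Theorem-3 doors at the Stage-13 record (dag-n09-w3 g2's small-field bookkeeping door, dag-n09-w4 g3's
`…N09B0RiderAtRecord.thm3Member_stage13SepCoPH_atDomAlt_of_numerics_of_εreg_eq`).  RE-SHAPED, NOT DISCHARGED: the chart and the continuity stay displayed.
[cite: Balaban1987RG1, p.259, (2.10) p.267 and (0.13) p.254] -/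
theorem domAlt_subset_regSetOfRecord_of_fibredChart (ν : Stage7Numerics) {K k : ℕ} (hk : k < K) {ρ : Density (F.P K) k (SU N)}
    (hρ : Integrable ρ (fieldMeasure (F.P K) k (SU N)))
    {S : Set (GaugeField (F.P K) k (SU N))} (hS : ∀ x, ρ x ≠ 0 → x ∈ S)
    {Φ : (PBond (F.P K) (k + 1) → SU N) × Z → GaugeField (F.P K) k (SU N)} {J : (PBond (F.P K) (k + 1) → SU N) × Z → ℝ≥0}
    (hΦ : Measurable Φ) (hJ : Measurable J) (havgΦ : ∀ V ∈ domAltOfRecord F N ν K (k + 1), ∀ z, (avOfRecord F N K k).avg (Φ (V, z)) = V)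
    (hmap : (fieldMeasure (F.P K) k (SU N)).restrict ((avOfRecord F N K k).avg ⁻¹' domAltOfRecord F N ν K (k + 1) ∩ S)
      = ((((piHaar (F.P K) (k + 1) (SU N)).restrict (domAltOfRecord F N ν K (k + 1))).prod τ).withDensity
          (fun p => (J p : ℝ≥0∞))).map Φ)
    (hgc : ContinuousOn (fun V => ∫ z, (J (V, z) : ℝ) * ρ (Φ (V, z)) ∂τ) (domAltOfRecord F N ν K (k + 1))) :
    domAltOfRecord F N ν K (k + 1) ⊆ regSetOfRecord F N K k ρ :=
  subset_regSetOfRecord_of_fibredChart hk hρ (isOpen_domAltOfRecord ν K (k + 1)) hS hΦ hJ havgΦ hmap hgc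

end Record


end Literature.MathematicalPhysics.QuantumFieldTheory.Balaban1983to89.Node00

end
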